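import Literature.AlgebraicTopology.SingularHomology.SubsetCochains
import HarnessLib

/-!
# The Mayer–Vietoris sequence in the cohomology of open subsets

A. Hatcher, *Algebraic Topology* (2002), §3.1, pp. 203–204, "Mayer–Vietoris sequences": for
`X = int A ∪ int B` there is a long exact sequence
`⋯ → Hⁿ(X; G) → Hⁿ(A; G) ⊕ Hⁿ(B; G) → Hⁿ(A ∩ B; G) → Hⁿ⁺¹(X; G) → ⋯`, obtained by dualising the
short exact sequence `0 → Cₙ(A ∩ B) → Cₙ(A) ⊕ Cₙ(B) → Cₙ(A + B) → 0` ("which is split since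
`Cₙ(A + B)` is free") and using that the restriction `Cⁿ(A ∪ B) → Cⁿ(A + B)` induces isomorphisms
on cohomology.

This file carries this out for the cohomology of open subsets `A`, `B ⊆ X` **computed inside
`C(X)`** (`subsetCochains R N A = Hom_R(C(A), N)`, `SubsetCochains.lean`), with the textbook maps:

* `subsetCochains.mvShortComplex A B` — the short complex of cochain complexes
  `Hom(C(A) + C(B), N) → Hom(C(A), N) ⊞ Hom(C(B), N) → Hom(C(A ∩ B), N)`,
  `ω ↦ (ω|, ω|)`, `(ψ, χ) ↦ ψ| - χ|`, PROVED short exact (`mvShortComplex_shortExact`) for all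
  `A`, `B`: it is isomorphic — through the sign-twisted biproduct comparison `dualBiprodIsoTwist`
  and `Hom(C(A) ⊓ C(B), N) ≅ Hom(C(A ∩ B), N)` — to the `Hom`-dual of the tree's Mayer–Vietoris
  sequence of subcomplexes (`Subcomplex.mvSub`), which is degreewise split (`(C(A) + C(B))ₙ` is
  free);
* for `A`, `B` open, the resulting long exact sequence rewritten on
  `H^p_X(A ∪ B) := H^p(Hom(C(A ∪ B), N))` (small cochains, `supHomologyIso`) and
  `H^p_X(A) ⊞ H^p_X(B)`: the maps `mvRes` (`a ↦ (a|A, a|B)`), `mvDiff` (`(b, c) ↦ b| - c|`), the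
  connecting map `mvδ`, and the three exactness statements `mv_exact₂`, `mv_exact₃`, `mv_exact₁`
  (Hatcher p. 204);
* naturality of `mvδ` under shrinking `(A', B') ⊆ (A, B)` (`mvδ_natural`), the input for the
  Mayer–Vietoris sequence of Čech cohomology.

Everything is proved; no named facts.

## References

* A. Hatcher, *Algebraic Topology*, CUP 2002, §3.1 pp. 203–204; §2.2 pp. 149–150. [HatcherAT2002]
-/

noncomputable section

open CategoryTheory Limits Opposite

universe u v

namespace Literature.AlgebraicTopology.SingularHomology

/-! ### Homology of a biproduct of complexes -/

section HomologyBiprod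

variable {R : Type v} [CommRing R] {ι : Type*} {c : ComplexShape ι}
  (K L : HomologicalComplex (ModuleCat.{u} R) c) (i : ι)

/-- **`H(K ⊞ L) ≅ H(K) ⊞ H(L)`** (additivity of homology): components the maps induced by the
projections, inverse by the inclusions. [folklore] -/
def homologyBiprodIso : (K ⊞ L).homology i ≅ K.homology i ⊞ L.homology i where
  hom := biprod.lift (HomologicalComplex.homologyMap (biprod.fst : K ⊞ L ⟶ K) i)
    (HomologicalComplex.homologyMap (biprod.snd : K ⊞ L ⟶ L) i)
  inv := biprod.desc (HomologicalComplex.homologyMap (biprod.inl : K ⟶ K ⊞ L) i)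
    (HomologicalComplex.homologyMap (biprod.inr : L ⟶ K ⊞ L) i)
  hom_inv_id := by
    rw [biprod.lift_desc, ← HomologicalComplex.homologyMap_comp,
      ← HomologicalComplex.homologyMap_comp, ← HomologicalComplex.homologyMap_add, biprod.total,
      HomologicalComplex.homologyMap_id]
  inv_hom_id := by
    apply biprod.hom_ext' <;> apply biprod.hom_ext
    · rw [biprod.inl_desc_assoc, Category.assoc, biprod.lift_fst,
        ← HomologicalComplex.homologyMap_comp, biprod.inl_fst, HomologicalComplex.homologyMap_id,
        Category.comp_id, biprod.inl_fst]
    · rw [biprod.inl_desc_assoc, Category.assoc, biprod.lift_snd,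
        ← HomologicalComplex.homologyMap_comp, biprod.inl_snd, HomologicalComplex.homologyMap_zero,
        Category.comp_id, biprod.inl_snd]
    · rw [biprod.inr_desc_assoc, Category.assoc, biprod.lift_fst,
        ← HomologicalComplex.homologyMap_comp, biprod.inr_fst, HomologicalComplex.homologyMap_zero,
        Category.comp_id, biprod.inr_fst]
    · rw [biprod.inr_desc_assoc, Category.assoc, biprod.lift_snd,
        ← HomologicalComplex.homologyMap_comp, biprod.inr_snd, HomologicalComplex.homologyMap_id,
        Category.comp_id, biprod.inr_snd]

/-- `inl ≫ (H(K ⊞ L) ≅ H K ⊞ H L)⁻¹ = H(inl)`. [folklore] -/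
@[reassoc]
lemma inl_homologyBiprodIso_inv : biprod.inl ≫ (homologyBiprodIso K L i).inv =
    HomologicalComplex.homologyMap (biprod.inl : K ⟶ K ⊞ L) i := biprod.inl_desc _ _

/-- `inr ≫ (H(K ⊞ L) ≅ H K ⊞ H L)⁻¹ = H(inr)`. [folklore] -/
@[reassoc]
lemma inr_homologyBiprodIso_inv : biprod.inr ≫ (homologyBiprodIso K L i).inv =
    HomologicalComplex.homologyMap (biprod.inr : L ⟶ K ⊞ L) i := biprod.inr_desc _ _

/-- `(H(K ⊞ L) ≅ H K ⊞ H L) ≫ fst = H(fst)`. [folklore] -/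
@[reassoc]
lemma homologyBiprodIso_hom_fst : (homologyBiprodIso K L i).hom ≫ biprod.fst =
    HomologicalComplex.homologyMap (biprod.fst : K ⊞ L ⟶ K) i := biprod.lift_fst _ _

/-- `(H(K ⊞ L) ≅ H K ⊞ H L) ≫ snd = H(snd)`. [folklore] -/
@[reassoc]
lemma homologyBiprodIso_hom_snd : (homologyBiprodIso K L i).hom ≫ biprod.snd =
    HomologicalComplex.homologyMap (biprod.snd : K ⊞ L ⟶ L) i := biprod.lift_snd _ _

end HomologyBiprod

/-! ### The Mayer–Vietoris short exact sequence of cochain complexes -/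

variable (R : Type v) [CommRing R] (N : ModuleCat.{max u v} R) {X : Type u} [TopologicalSpace X]

/-- The relation `p ~ p + 1` of the cohomological shape `(down ℕ).symm` (used to index
connecting maps uniformly). [folklore] -/
lemma crel (p : ℕ) : (ComplexShape.down ℕ).symm.Rel p (p + 1) := rfl

namespace subsetCochains

/-- Local notation: the subcomplex `C(A) ⊆ C(X)`. -/
local notation "𝑆" A:arg => chainsInSub R R X A

/-- **The Mayer–Vietoris short complex of cochain complexes**
`Hom(C(A) + C(B), N) → Hom(C(A), N) ⊞ Hom(C(B), N) → Hom(C(A ∩ B), N)`,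
`ω ↦ (ω|, ω|)`, `(ψ, χ) ↦ ψ| - χ|` (Hatcher 2002, §3.1, p. 204, the dual of
`0 → Cₙ(A ∩ B) → Cₙ(A) ⊕ Cₙ(B) → Cₙ(A + B) → 0`, with the textbook signs). [cite: HatcherAT2002, §3.1 p. 204] -/
abbrev mvShortComplex (A B : Set X) :
    ShortComplex (HomologicalComplex (ModuleCat.{max u v} R) (ComplexShape.down ℕ).symm) where
  X₁ := dualObj R N (𝑆 A ⊔ 𝑆 B).toComplex
  X₂ := subsetCochains R N A ⊞ subsetCochains R N B
  X₃ := subsetCochains R N (A ∩ B)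
  f := biprod.lift (dualMap R N (Subcomplex.incl (le_sup_left : 𝑆 A ≤ 𝑆 A ⊔ 𝑆 B)))
    (dualMap R N (Subcomplex.incl (le_sup_right : 𝑆 B ≤ 𝑆 A ⊔ 𝑆 B)))
  g := biprod.desc (res R N Set.inter_subset_left) (-res R N Set.inter_subset_right)
  zero := by
    rw [biprod.lift_desc, Preadditive.comp_neg, res, res, ← dualMap_comp, ← dualMap_comp,
      Subcomplex.incl_comp_incl, Subcomplex.incl_comp_incl]
    exact add_neg_eq_zero.mpr rfl

/-- The Mayer–Vietoris short complex of cochain complexes is isomorphic to the `Hom`-dual of the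
tree's Mayer–Vietoris short exact sequence of chain complexes `Subcomplex.mvSub` (through the
sign-twisted biproduct comparison on the middle term and `Hom(C(A) ⊓ C(B), N) ≅ Hom(C(A ∩ B), N)`
on the third). [folklore] -/
def mvShortComplexIso (A B : Set X) :
    mvShortComplex R N A B ≅ dualShortComplex (N := N) (Subcomplex.mvSub (𝑆 A) (𝑆 B)) :=
  ShortComplex.isoMk (S₁ := mvShortComplex R N A B)
    (S₂ := dualShortComplex (N := N) (Subcomplex.mvSub (𝑆 A) (𝑆 B)))
    (Iso.refl _) (dualBiprodIsoTwist (𝑆 A).toComplex (𝑆 B).toComplex) (interIso R N A B).symm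
    (by
      change 𝟙 _ ≫ dualMap R N (Subcomplex.mvSubG (𝑆 A) (𝑆 B)) =
        biprod.lift _ _ ≫ (dualBiprodIsoTwist _ _).hom
      rw [Category.id_comp, Subcomplex.mvSubG, biprod.desc_eq, dualMap_add, dualMap_comp,
        Preadditive.comp_neg, dualMap_neg, dualMap_comp, biprod.lift_eq, Preadditive.add_comp,
        Category.assoc, Category.assoc, inl_dualBiprodIsoTwist_hom, inr_dualBiprodIsoTwist_hom,
        Preadditive.comp_neg])
    (by
      change (dualBiprodIsoTwist _ _).hom ≫ dualMap R N (Subcomplex.mvSubF (𝑆 A) (𝑆 B)) =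
        biprod.desc _ _ ≫ (interIso R N A B).inv
      rw [Iso.eq_comp_inv, Category.assoc]
      apply biprod.hom_ext'
      · rw [inl_dualBiprodIsoTwist_hom_assoc, ← dualMap_comp_assoc, Subcomplex.mvSubF,
          biprod.lift_fst, dualMap_inf_le_left_comp_interIso_hom, biprod.inl_desc]
      · rw [inr_dualBiprodIsoTwist_hom_assoc, Preadditive.neg_comp, ← dualMap_comp_assoc,
          Subcomplex.mvSubF, biprod.lift_snd, dualMap_inf_le_right_comp_interIso_hom, biprod.inr_desc])

/-- **The Mayer–Vietoris short complex of cochain complexes is short exact** (for all subsets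
`A`, `B`): the dual of a degreewise split short exact sequence — `(C(A) + C(B))ₙ` is free
(Hatcher 2002, §3.1, p. 204: "which is split since `Cₙ(A + B)` is free").
[cite: HatcherAT2002, §3.1 p. 204] -/
theorem mvShortComplex_shortExact (A B : Set X) : (mvShortComplex R N A B).ShortExact := by
  haveI : ∀ i, Projective ((Subcomplex.mvSub (𝑆 A) (𝑆 B)).X₃.X i) :=
    fun i => projective_chainsInSub_sup_X R A B i
  exact (ShortComplex.shortExact_iff_of_iso (mvShortComplexIso R N A B)).2
    (dualShortComplex_shortExact_of_projective _ (Subcomplex.mvSub_shortExact _ _))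

/-! ### The long exact sequence on `H^p_X(A ∪ B)`, `H^p_X(A) ⊞ H^p_X(B)`, `H^p_X(A ∩ B)` -/

variable {R N}

/-- The map induced on cohomology by restriction along `A ⊆ B`. [folklore] -/
abbrev resH {A B : Set X} (h : A ⊆ B) (p : ℕ) :
    (subsetCochains R N B).homology p ⟶ (subsetCochains R N A).homology p :=
  HomologicalComplex.homologyMap (res R N h) p

variable (R N)

/-- **`H^p_X(A ∪ B) → H^p_X(A) ⊞ H^p_X(B)`, `a ↦ (a|A, a|B)`** (Hatcher 2002, §3.1, p. 204).
[cite: HatcherAT2002, §3.1 p. 204] -/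
def mvRes (A B : Set X) (p : ℕ) : (subsetCochains R N (A ∪ B)).homology p ⟶
    (subsetCochains R N A).homology p ⊞ (subsetCochains R N B).homology p :=
  biprod.lift (resH Set.subset_union_left p) (resH Set.subset_union_right p)

/-- **`H^p_X(A) ⊞ H^p_X(B) → H^p_X(A ∩ B)`, `(b, c) ↦ b| - c|`** (Hatcher 2002, §3.1, p. 204).
[cite: HatcherAT2002, §3.1 p. 204] -/
def mvDiff (A B : Set X) (p : ℕ) :
    (subsetCochains R N A).homology p ⊞ (subsetCochains R N B).homology p ⟶
      (subsetCochains R N (A ∩ B)).homology p :=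
  biprod.desc (resH Set.inter_subset_left p) (-resH Set.inter_subset_right p)

/-- **The Mayer–Vietoris connecting map `δ : H^p_X(A ∩ B) → H^{p+1}_X(A ∪ B)`** for open `A`,
`B` (Hatcher 2002, §3.1, p. 204): the connecting map of `mvShortComplex` followed by the
small-cochains isomorphism `H(Hom(C(A) + C(B), N)) ≅ H^*_X(A ∪ B)`. [cite: HatcherAT2002, §3.1 p. 204] -/
def mvδ {A B : Set X} (hA : IsOpen A) (hB : IsOpen B) (p : ℕ) :
    (subsetCochains R N (A ∩ B)).homology p ⟶ (subsetCochains R N (A ∪ B)).homology (p + 1) :=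
  (mvShortComplex_shortExact R N A B).δ p (p + 1) (crel p) ≫ (supHomologyIso (N := N) hA hB (p + 1)).hom

/-- `mvRes ≫ mvDiff = 0`. [folklore] -/
@[reassoc]
lemma mvRes_mvDiff (A B : Set X) (p : ℕ) : mvRes R N A B p ≫ mvDiff R N A B p = 0 := by
  rw [mvRes, mvDiff, biprod.lift_desc, Preadditive.comp_neg, ← HomologicalComplex.homologyMap_comp,
    ← HomologicalComplex.homologyMap_comp, ← res_comp, ← res_comp]
  exact add_neg_eq_zero.mpr rfl

variable {R N}

/-- `mvRes` compared with `H(f)` of `mvShortComplex` through the small-cochains isomorphism: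
`supHomologyIso ≫ mvRes = H(f) ≫ (H(⊞) ≅ ⊞)`. [folklore] -/
lemma supHomologyIso_hom_comp_mvRes {A B : Set X} (hA : IsOpen A) (hB : IsOpen B) (p : ℕ) :
    (supHomologyIso (N := N) hA hB p).hom ≫ mvRes R N A B p =
      HomologicalComplex.homologyMap (mvShortComplex R N A B).f p ≫
        (homologyBiprodIso (subsetCochains R N A) (subsetCochains R N B) p).hom := by
  haveI := isIso_homologyMap_resSup (N := N) hA hB p
  change inv (HomologicalComplex.homologyMap (resSup R N A B) p) ≫ mvRes R N A B p = _
  rw [IsIso.inv_comp_eq]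
  apply biprod.hom_ext
  · rw [Category.assoc, mvRes, biprod.lift_fst, Category.assoc, homologyBiprodIso_hom_fst,
      ← HomologicalComplex.homologyMap_comp, ← HomologicalComplex.homologyMap_comp]
    change resH _ p = HomologicalComplex.homologyMap (resSup R N A B ≫ biprod.lift _ _ ≫ biprod.fst) p
    rw [biprod.lift_fst, resSup, ← dualMap_comp, Subcomplex.incl_comp_incl]
  · rw [Category.assoc, mvRes, biprod.lift_snd, Category.assoc, homologyBiprodIso_hom_snd,
      ← HomologicalComplex.homologyMap_comp, ← HomologicalComplex.homologyMap_comp]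
    change resH _ p = HomologicalComplex.homologyMap (resSup R N A B ≫ biprod.lift _ _ ≫ biprod.snd) p
    rw [biprod.lift_snd, resSup, ← dualMap_comp, Subcomplex.incl_comp_incl]

/-- `mvDiff` compared with `H(g)` of `mvShortComplex`: `(H(⊞) ≅ ⊞) ≫ mvDiff = H(g)`. [folklore] -/
lemma homologyBiprodIso_hom_comp_mvDiff (A B : Set X) (p : ℕ) :
    (homologyBiprodIso (subsetCochains R N A) (subsetCochains R N B) p).hom ≫ mvDiff R N A B p =
      HomologicalComplex.homologyMap (mvShortComplex R N A B).g p := by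
  rw [← Iso.eq_inv_comp]
  apply biprod.hom_ext'
  · rw [mvDiff, biprod.inl_desc, inl_homologyBiprodIso_inv_assoc,
      ← HomologicalComplex.homologyMap_comp]
    change _ = HomologicalComplex.homologyMap (biprod.inl ≫ biprod.desc _ _) p
    rw [biprod.inl_desc]
  · rw [mvDiff, biprod.inr_desc, inr_homologyBiprodIso_inv_assoc,
      ← HomologicalComplex.homologyMap_comp]
    change _ = HomologicalComplex.homologyMap (biprod.inr ≫ biprod.desc _ _) p
    rw [biprod.inr_desc, HomologicalComplex.homologyMap_neg]

/-- **Exactness of `H^p_X(A ∪ B) → H^p_X(A) ⊞ H^p_X(B) → H^p_X(A ∩ B)`** for open `A`, `B`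
(Hatcher 2002, §3.1, p. 204). [cite: HatcherAT2002, §3.1 p. 204] -/
theorem mv_exact₂ {A B : Set X} (hA : IsOpen A) (hB : IsOpen B) (p : ℕ) :
    (ShortComplex.mk (mvRes R N A B p) (mvDiff R N A B p) (mvRes_mvDiff R N A B p)).Exact := by
  let S₁ : ShortComplex (ModuleCat.{max u v} R) :=
    ShortComplex.mk (HomologicalComplex.homologyMap (mvShortComplex R N A B).f p)
      (HomologicalComplex.homologyMap (mvShortComplex R N A B).g p)
      (by rw [← HomologicalComplex.homologyMap_comp, (mvShortComplex R N A B).zero,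
        HomologicalComplex.homologyMap_zero])
  let S₂ : ShortComplex (ModuleCat.{max u v} R) :=
    ShortComplex.mk (mvRes R N A B p) (mvDiff R N A B p) (mvRes_mvDiff R N A B p)
  have h₁ : S₁.Exact := (mvShortComplex_shortExact R N A B).homology_exact₂ p
  have e : S₁ ≅ S₂ := ShortComplex.isoMk (S₁ := S₁) (S₂ := S₂) (supHomologyIso (N := N) hA hB p)
    (homologyBiprodIso (subsetCochains R N A) (subsetCochains R N B) p) (Iso.refl _)
    (supHomologyIso_hom_comp_mvRes (R := R) (N := N) hA hB p)
    (by
      change (homologyBiprodIso _ _ p).hom ≫ mvDiff R N A B p =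
        HomologicalComplex.homologyMap (mvShortComplex R N A B).g p ≫ 𝟙 _
      rw [Category.comp_id, homologyBiprodIso_hom_comp_mvDiff])
  exact (ShortComplex.exact_iff_of_iso e).1 h₁

/-- `mvDiff ≫ mvδ = 0`. [folklore] -/
@[reassoc]
lemma mvDiff_mvδ {A B : Set X} (hA : IsOpen A) (hB : IsOpen B) (p : ℕ) :
    mvDiff R N A B p ≫ mvδ R N hA hB p = 0 := by
  rw [← cancel_epi (homologyBiprodIso (subsetCochains R N A) (subsetCochains R N B) p).hom,
    ← Category.assoc, homologyBiprodIso_hom_comp_mvDiff, mvδ,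
    (mvShortComplex_shortExact R N A B).comp_δ_assoc, zero_comp, comp_zero]

/-- **Exactness of `H^p_X(A) ⊞ H^p_X(B) → H^p_X(A ∩ B) → H^{p+1}_X(A ∪ B)`** for open `A`, `B`
(Hatcher 2002, §3.1, p. 204). [cite: HatcherAT2002, §3.1 p. 204] -/
theorem mv_exact₃ {A B : Set X} (hA : IsOpen A) (hB : IsOpen B) (p : ℕ) :
    (ShortComplex.mk (mvDiff R N A B p) (mvδ R N hA hB p) (mvDiff_mvδ hA hB p)).Exact := by
  let S₁ : ShortComplex (ModuleCat.{max u v} R) :=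
    ShortComplex.mk (HomologicalComplex.homologyMap (mvShortComplex R N A B).g p)
      ((mvShortComplex_shortExact R N A B).δ p (p + 1) (crel p))
      ((mvShortComplex_shortExact R N A B).comp_δ p (p + 1) (crel p))
  let S₂ : ShortComplex (ModuleCat.{max u v} R) :=
    ShortComplex.mk (mvDiff R N A B p) (mvδ R N hA hB p) (mvDiff_mvδ hA hB p)
  have h₁ : S₁.Exact := (mvShortComplex_shortExact R N A B).homology_exact₃ p (p + 1) (crel p)
  have e : S₁ ≅ S₂ := ShortComplex.isoMk (S₁ := S₁) (S₂ := S₂)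
    (homologyBiprodIso (subsetCochains R N A) (subsetCochains R N B) p) (Iso.refl _)
    (supHomologyIso (N := N) hA hB (p + 1))
    (by
      change (homologyBiprodIso _ _ p).hom ≫ mvDiff R N A B p =
        HomologicalComplex.homologyMap (mvShortComplex R N A B).g p ≫ 𝟙 _
      rw [Category.comp_id, homologyBiprodIso_hom_comp_mvDiff])
    (by
      change 𝟙 _ ≫ mvδ R N hA hB p = (mvShortComplex_shortExact R N A B).δ p (p + 1) (crel p) ≫ _
      rw [Category.id_comp, mvδ])
  exact (ShortComplex.exact_iff_of_iso e).1 h₁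

/-- `mvδ ≫ mvRes = 0`. [folklore] -/
@[reassoc]
lemma mvδ_mvRes {A B : Set X} (hA : IsOpen A) (hB : IsOpen B) (p : ℕ) :
    mvδ R N hA hB p ≫ mvRes R N A B (p + 1) = 0 := by
  rw [mvδ, Category.assoc, supHomologyIso_hom_comp_mvRes hA hB (p + 1),
    (mvShortComplex_shortExact R N A B).δ_comp_assoc, zero_comp]

/-- **Exactness of `H^p_X(A ∩ B) → H^{p+1}_X(A ∪ B) → H^{p+1}_X(A) ⊞ H^{p+1}_X(B)`** for open
`A`, `B` (Hatcher 2002, §3.1, p. 204). [cite: HatcherAT2002, §3.1 p. 204] -/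
theorem mv_exact₁ {A B : Set X} (hA : IsOpen A) (hB : IsOpen B) (p : ℕ) :
    (ShortComplex.mk (mvδ R N hA hB p) (mvRes R N A B (p + 1)) (mvδ_mvRes hA hB p)).Exact := by
  let S₁ : ShortComplex (ModuleCat.{max u v} R) :=
    ShortComplex.mk ((mvShortComplex_shortExact R N A B).δ p (p + 1) (crel p))
      (HomologicalComplex.homologyMap (mvShortComplex R N A B).f (p + 1))
      ((mvShortComplex_shortExact R N A B).δ_comp p (p + 1) (crel p))
  let S₂ : ShortComplex (ModuleCat.{max u v} R) :=
    ShortComplex.mk (mvδ R N hA hB p) (mvRes R N A B (p + 1)) (mvδ_mvRes hA hB p)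
  have h₁ : S₁.Exact := (mvShortComplex_shortExact R N A B).homology_exact₁ p (p + 1) (crel p)
  have e : S₁ ≅ S₂ := ShortComplex.isoMk (S₁ := S₁) (S₂ := S₂) (Iso.refl _)
    (supHomologyIso (N := N) hA hB (p + 1))
    (homologyBiprodIso (subsetCochains R N A) (subsetCochains R N B) (p + 1))
    (by
      change 𝟙 _ ≫ mvδ R N hA hB p = (mvShortComplex_shortExact R N A B).δ p (p + 1) (crel p) ≫ _
      rw [Category.id_comp, mvδ])
    (supHomologyIso_hom_comp_mvRes (R := R) (N := N) hA hB (p + 1))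
  exact (ShortComplex.exact_iff_of_iso e).1 h₁

/-! ### Naturality under shrinking -/

/-- The morphism of Mayer–Vietoris short complexes induced by shrinking `(A', B') ⊆ (A, B)`:
restriction in each term. [folklore] -/
abbrev mvShortComplexMap {A A' B B' : Set X} (hA : A' ⊆ A) (hB : B' ⊆ B) :
    mvShortComplex R N A B ⟶ mvShortComplex R N A' B' where
  τ₁ := dualMap R N (Subcomplex.incl (sup_le_sup (chainsInSub_mono R R hA) (chainsInSub_mono R R hB)))
  τ₂ := biprod.map (res R N hA) (res R N hB)
  τ₃ := res R N (Set.inter_subset_inter hA hB)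
  comm₁₂ := by
    change dualMap R N _ ≫ biprod.lift _ _ = biprod.lift _ _ ≫ biprod.map _ _
    apply biprod.hom_ext
    · rw [Category.assoc, biprod.lift_fst, Category.assoc, biprod.map_fst, biprod.lift_fst_assoc, res,
        ← dualMap_comp, ← dualMap_comp, Subcomplex.incl_comp_incl, Subcomplex.incl_comp_incl]
    · rw [Category.assoc, biprod.lift_snd, Category.assoc, biprod.map_snd, biprod.lift_snd_assoc, res,
        ← dualMap_comp, ← dualMap_comp, Subcomplex.incl_comp_incl, Subcomplex.incl_comp_incl]
  comm₂₃ := by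
    change biprod.map _ _ ≫ biprod.desc _ _ = biprod.desc _ _ ≫ res R N _
    apply biprod.hom_ext'
    · rw [biprod.inl_map_assoc, biprod.inl_desc, biprod.inl_desc_assoc, ← res_comp, ← res_comp]
    · rw [biprod.inr_map_assoc, biprod.inr_desc, biprod.inr_desc_assoc, Preadditive.neg_comp,
        Preadditive.comp_neg, ← res_comp, ← res_comp]

/-- **Naturality of the Mayer–Vietoris connecting map under shrinking**: for open
`A' ⊆ A`, `B' ⊆ B`, `δ ≫ res = res ≫ δ'` (Hatcher 2002, §3.1, p. 204 with §2.2, p. 150,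
naturality of the connecting homomorphism). [cite: HatcherAT2002, §3.1 p. 204] -/
theorem mvδ_natural {A A' B B' : Set X} (hAo : IsOpen A) (hBo : IsOpen B) (hA'o : IsOpen A')
    (hB'o : IsOpen B') (hA : A' ⊆ A) (hB : B' ⊆ B) (p : ℕ) :
    mvδ R N hAo hBo p ≫ resH (Set.union_subset_union hA hB) (p + 1) =
      resH (Set.inter_subset_inter hA hB) p ≫ mvδ R N hA'o hB'o p := by
  have hnat := HomologicalComplex.HomologySequence.δ_naturality (mvShortComplexMap (N := N) hA hB)
    (mvShortComplex_shortExact R N A B) (mvShortComplex_shortExact R N A' B') p (p + 1) (crel p)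
  -- `hnat : δ ≫ H(τ₁) = H(τ₃) ≫ δ'`, and `H(τ₃) = resH`
  haveI := isIso_homologyMap_resSup (N := N) hAo hBo (p + 1)
  haveI := isIso_homologyMap_resSup (N := N) hA'o hB'o (p + 1)
  -- the `X₁` ends, at chain level: `resSup ≫ τ₁ = res ≫ resSup'`
  have h₀ : resSup R N A B ≫ (mvShortComplexMap (N := N) hA hB).τ₁ =
      res R N (Set.union_subset_union hA hB) ≫ resSup R N A' B' := by
    change dualMap R N _ ≫ dualMap R N _ = dualMap R N _ ≫ dualMap R N _
    rw [← dualMap_comp, ← dualMap_comp, Subcomplex.incl_comp_incl, Subcomplex.incl_comp_incl]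
  -- hence `supHomologyIso ≫ resH = H(τ₁) ≫ supHomologyIso'`
  have h₁ : (supHomologyIso (N := N) hAo hBo (p + 1)).hom ≫ resH (Set.union_subset_union hA hB) (p + 1) =
      HomologicalComplex.homologyMap (mvShortComplexMap (N := N) hA hB).τ₁ (p + 1) ≫
        (supHomologyIso (N := N) hA'o hB'o (p + 1)).hom := by
    change inv (HomologicalComplex.homologyMap (resSup R N A B) (p + 1)) ≫ _ =
      _ ≫ inv (HomologicalComplex.homologyMap (resSup R N A' B') (p + 1))
    rw [IsIso.inv_comp_eq, ← Category.assoc, IsIso.eq_comp_inv, ← HomologicalComplex.homologyMap_comp,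
      ← HomologicalComplex.homologyMap_comp, h₀]
  rw [mvδ, mvδ, Category.assoc, h₁, ← Category.assoc, hnat, Category.assoc]

/-! ### Elementwise forms (for direct-limit arguments) -/

section Elementwise

/-- If `f ≫ g = 0` then `g (f x) = 0`. [folklore] -/
lemma apply_apply_eq_zero_of_comp_eq_zero {A' B' C' : ModuleCat.{max u v} R} {f : A' ⟶ B'}
    {g : B' ⟶ C'} (h : f ≫ g = 0) (x : A') : g (f x) = 0 := by
  rw [← ModuleCat.comp_apply, h]
  rfl

/-- An element of a biproduct of modules is the sum of its two components. [folklore] -/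
lemma biprod_decomp {A B : ModuleCat.{max u v} R} (x : ↑(A ⊞ B)) :
    x = (biprod.inl : A ⟶ A ⊞ B) ((biprod.fst : A ⊞ B ⟶ A) x) +
      (biprod.inr : B ⟶ A ⊞ B) ((biprod.snd : A ⊞ B ⟶ B) x) := by
  have h := ConcreteCategory.congr_hom (biprod.total : _ = 𝟙 (A ⊞ B)) x
  rw [ModuleCat.id_apply] at h
  conv_lhs => rw [← h]
  rfl

/-- `fst (inl a + inr b) = a`. [folklore] -/
lemma biprod_fst_inl_add_inr {A B : ModuleCat.{max u v} R} (a : A) (b : B) :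
    (biprod.fst : A ⊞ B ⟶ A) ((biprod.inl : A ⟶ A ⊞ B) a + (biprod.inr : B ⟶ A ⊞ B) b) = a := by
  rw [map_add, ← ModuleCat.comp_apply, ← ModuleCat.comp_apply, biprod.inl_fst, biprod.inr_fst,
    ModuleCat.id_apply]
  exact add_zero a

/-- `snd (inl a + inr b) = b`. [folklore] -/
lemma biprod_snd_inl_add_inr {A B : ModuleCat.{max u v} R} (a : A) (b : B) :
    (biprod.snd : A ⊞ B ⟶ B) ((biprod.inl : A ⟶ A ⊞ B) a + (biprod.inr : B ⟶ A ⊞ B) b) = b := by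
  rw [map_add, ← ModuleCat.comp_apply, ← ModuleCat.comp_apply, biprod.inl_snd, biprod.inr_snd,
    ModuleCat.id_apply]
  exact zero_add b

variable {A B : Set X}

/-- The components of `mvRes c` are the two restrictions of `c`. [folklore] -/
lemma fst_mvRes (p : ℕ) (c : (subsetCochains R N (A ∪ B)).homology p) :
    (biprod.fst : _ ⟶ (subsetCochains R N A).homology p) (mvRes R N A B p c) =
      resH Set.subset_union_left p c := by
  rw [← ModuleCat.comp_apply, mvRes, biprod.lift_fst]

/-- The components of `mvRes c` are the two restrictions of `c`. [folklore] -/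
lemma snd_mvRes (p : ℕ) (c : (subsetCochains R N (A ∪ B)).homology p) :
    (biprod.snd : _ ⟶ (subsetCochains R N B).homology p) (mvRes R N A B p c) =
      resH Set.subset_union_right p c := by
  rw [← ModuleCat.comp_apply, mvRes, biprod.lift_snd]

/-- `mvDiff (inl a + inr b) = a| - b|`. [folklore] -/
lemma mvDiff_inl_add_inr (p : ℕ) (a : (subsetCochains R N A).homology p)
    (b : (subsetCochains R N B).homology p) :
    mvDiff R N A B p ((biprod.inl : _ ⟶ _ ⊞ (subsetCochains R N B).homology p) a +
      (biprod.inr : _ ⟶ (subsetCochains R N A).homology p ⊞ _) b) =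
      resH Set.inter_subset_left p a - resH Set.inter_subset_right p b := by
  rw [map_add, ← ModuleCat.comp_apply, ← ModuleCat.comp_apply, mvDiff, biprod.inl_desc,
    biprod.inr_desc, sub_eq_add_neg]
  rfl

/-- **Exactness at `H^p_X(A) ⊞ H^p_X(B)`, elementwise**: two classes on open `A`, `B` which agree on
`A ∩ B` are the restrictions of one class on `A ∪ B` (Hatcher 2002, §3.1, p. 204).
[cite: HatcherAT2002, §3.1 p. 204] -/
theorem exists_of_res_eq_res (hA : IsOpen A) (hB : IsOpen B) {p : ℕ}
    (a : (subsetCochains R N A).homology p) (b : (subsetCochains R N B).homology p)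
    (h : resH Set.inter_subset_left p a = resH Set.inter_subset_right p b) :
    ∃ c : (subsetCochains R N (A ∪ B)).homology p,
      resH Set.subset_union_left p c = a ∧ resH Set.subset_union_right p c = b := by
  set x := (biprod.inl : _ ⟶ _ ⊞ (subsetCochains R N B).homology p) a +
    (biprod.inr : _ ⟶ (subsetCochains R N A).homology p ⊞ _) b with hx
  have hx0 : mvDiff R N A B p x = 0 := by rw [hx, mvDiff_inl_add_inr, h, sub_self]
  obtain ⟨c, hc⟩ := ((ShortComplex.moduleCat_exact_iff _).1 (mv_exact₂ (N := N) hA hB p)) x hx0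
  refine ⟨c, ?_, ?_⟩
  · rw [← fst_mvRes, show mvRes R N A B p c = x from hc, hx, biprod_fst_inl_add_inr]
  · rw [← snd_mvRes, show mvRes R N A B p c = x from hc, hx, biprod_snd_inl_add_inr]

/-- **Exactness at `H^p_X(A ∩ B)`, elementwise**: a class on `A ∩ B` killed by `δ` is a difference
of restrictions (Hatcher 2002, §3.1, p. 204). [cite: HatcherAT2002, §3.1 p. 204] -/
theorem exists_of_mvδ_eq_zero (hA : IsOpen A) (hB : IsOpen B) {p : ℕ}
    (e : (subsetCochains R N (A ∩ B)).homology p) (h : mvδ R N hA hB p e = 0) :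
    ∃ (a : (subsetCochains R N A).homology p) (b : (subsetCochains R N B).homology p),
      e = resH Set.inter_subset_left p a - resH Set.inter_subset_right p b := by
  obtain ⟨x, hx⟩ := ((ShortComplex.moduleCat_exact_iff _).1 (mv_exact₃ (N := N) hA hB p)) e h
  refine ⟨(biprod.fst : (subsetCochains R N A).homology p ⊞ (subsetCochains R N B).homology p ⟶ _) x,
    (biprod.snd : (subsetCochains R N A).homology p ⊞ (subsetCochains R N B).homology p ⟶ _) x, ?_⟩
  rw [← mvDiff_inl_add_inr, ← biprod_decomp x]
  exact hx.symm

/-- **Exactness at `H^{p+1}_X(A ∪ B)`, elementwise**: a class on `A ∪ B` vanishing on `A` and on `B`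
is in the image of `δ` (Hatcher 2002, §3.1, p. 204). [cite: HatcherAT2002, §3.1 p. 204] -/
theorem exists_of_res_eq_zero (hA : IsOpen A) (hB : IsOpen B) {p : ℕ}
    (c : (subsetCochains R N (A ∪ B)).homology (p + 1)) (ha : resH Set.subset_union_left (p + 1) c = 0)
    (hb : resH Set.subset_union_right (p + 1) c = 0) :
    ∃ e : (subsetCochains R N (A ∩ B)).homology p, mvδ R N hA hB p e = c := by
  have h0 : mvRes R N A B (p + 1) c = 0 := by
    rw [biprod_decomp (mvRes R N A B (p + 1) c), fst_mvRes, snd_mvRes, ha, hb, map_zero, map_zero,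
      add_zero]
  exact ((ShortComplex.moduleCat_exact_iff _).1 (mv_exact₁ (N := N) hA hB p)) c h0

/-- `δ` kills differences of restrictions: `δ (a|) = 0` (Hatcher 2002, §3.1, p. 204). [folklore] -/
theorem mvδ_res_left (hA : IsOpen A) (hB : IsOpen B) {p : ℕ} (a : (subsetCochains R N A).homology p) :
    mvδ R N hA hB p (resH Set.inter_subset_left p a) = 0 := by
  have h := apply_apply_eq_zero_of_comp_eq_zero (mvDiff_mvδ (N := N) hA hB p)
    ((biprod.inl : _ ⟶ _ ⊞ (subsetCochains R N B).homology p) a +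
      (biprod.inr : _ ⟶ (subsetCochains R N A).homology p ⊞ _) 0)
  rwa [mvDiff_inl_add_inr, map_zero, sub_zero] at h

/-- `δ (b|) = 0`. [folklore] -/
theorem mvδ_res_right (hA : IsOpen A) (hB : IsOpen B) {p : ℕ} (b : (subsetCochains R N B).homology p) :
    mvδ R N hA hB p (resH Set.inter_subset_right p b) = 0 := by
  have h := apply_apply_eq_zero_of_comp_eq_zero (mvDiff_mvδ (N := N) hA hB p)
    ((biprod.inl : _ ⟶ _ ⊞ (subsetCochains R N B).homology p) 0 +
      (biprod.inr : _ ⟶ (subsetCochains R N A).homology p ⊞ _) b)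
  rwa [mvDiff_inl_add_inr, map_zero, zero_sub, map_neg, neg_eq_zero] at h

/-- `(δ e)|A = 0`. [folklore] -/
theorem res_left_mvδ (hA : IsOpen A) (hB : IsOpen B) {p : ℕ} (e : (subsetCochains R N (A ∩ B)).homology p) :
    resH Set.subset_union_left (p + 1) (mvδ R N hA hB p e) = 0 := by
  rw [← fst_mvRes, apply_apply_eq_zero_of_comp_eq_zero (mvδ_mvRes (N := N) hA hB p) e, map_zero]

/-- `(δ e)|B = 0`. [folklore] -/
theorem res_right_mvδ (hA : IsOpen A) (hB : IsOpen B) {p : ℕ} (e : (subsetCochains R N (A ∩ B)).homology p) :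
    resH Set.subset_union_right (p + 1) (mvδ R N hA hB p e) = 0 := by
  rw [← snd_mvRes, apply_apply_eq_zero_of_comp_eq_zero (mvδ_mvRes (N := N) hA hB p) e, map_zero]

/-- Naturality of `δ`, elementwise. [folklore] -/
theorem mvδ_natural_apply {A' B' : Set X} (hAo : IsOpen A) (hBo : IsOpen B) (hA'o : IsOpen A')
    (hB'o : IsOpen B') (hA : A' ⊆ A) (hB : B' ⊆ B) {p : ℕ} (e : (subsetCochains R N (A ∩ B)).homology p) :
    resH (Set.union_subset_union hA hB) (p + 1) (mvδ R N hAo hBo p e) =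
      mvδ R N hA'o hB'o p (resH (Set.inter_subset_inter hA hB) p e) := by
  have h := ConcreteCategory.congr_hom (mvδ_natural (N := N) hAo hBo hA'o hB'o hA hB p) e
  rwa [ModuleCat.comp_apply, ModuleCat.comp_apply] at h

end Elementwise

end subsetCochains

end Literature.AlgebraicTopology.SingularHomology
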